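import Literature.AlgebraicGeometry.AbelianSchemes.TorsionPowerRebasingAction
import Literature.AlgebraicGeometry.AbelianSchemes.LevelBasisFiniteEtaleCoverSurjective
import Literature.AlgebraicGeometry.RelativeSpec.FiniteGroupQuotientGluing
import HarnessLib

/-!
# The level-`M`-basis cover of an abelian scheme is a `GL_{2g}(ℤ/M)`-torsor: action by re-basing, trivial stabilisers,
# transitive geometric fibres

Layer `Literature/AlgebraicGeometry/AbelianSchemes`, namespace `Literature.AlgebraicGeometry.AbelianSchemes.AbelianSchemeOver`.
THEOREMS ONLY (no `def`, no instance, no notation, no `sorry`).  Cell `hodgecm-mathlib` (D-0151), F-3 (M) carrier package (Ma0)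
FILE B2 (B-plan1 (g19) M-cut v0.1 «CARRIER DECISION»).  HC_CM is proved only modulo the 7 printed citations until rung 0 closes;
nothing here is about HC.

## Source
[MumfordFogartyKirwan1994] Ch. 7 §2, proof of Prop. 7.3, step (IV) (pp. 133–134): the basis locus `H₄` inside the fibre power
of the `n`-torsion, on which «`GL(2g, ℤ/n)` acts … by change of the level structure», and §3 Lemma 7.11 (p. 140) (the scheme of
level-`n` structures is finite étale over the base, a principal homogeneous space under `GL(2g, ℤ/nℤ)`); [GortzWedhorn2023]
Prop. 27.188 (1) (`X[n]` is étale-locally `(ℤ/nℤ)^{2g}`); [SGA1] Exp. V Déf. 2.7 (revêtement principal de groupe `G`).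

## What is proved
**`exists_levelBasisCover_rebase`** — for an abelian scheme `A/S` of relative dimension `g` with commutative group law and
`M ≠ 0` invertible in the residue fields of `S`: a finite étale surjective `b : B → S` (the clopen BASIS LOCUS of the fibre power
`A[M]^{×_S 2g}`, exactly as in ★ `exists_finite_etale_levelStructure`, whose construction is re-run here because that theorem's `∃`
hides the functor of points of `B`) together with
* an action `ρ : ActionOver b (GL (Fin g ⊕ Fin g) (ℤ/M))` (★ FILE B1 `exists_actionOver_rebase` on the fibre power, RESTRICTED to
  the `GL`-stable basis locus by ★ `ActionOver.restrict`),
* a level-`M` structure on `A ×_S B`, and on `A ×_S W` for every `j : W → B`,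
* TRIVIAL STABILISERS on field-valued points: `x ≫ ρ(γ₀) = x ⇒ γ₀ = 1` (a basis is moved by every `γ₀ ≠ 1`),
* TRANSITIVITY on geometric fibres: two `Ω`-points of `B` (`Ω` algebraically closed) over the same point of `S` differ by some
  `ρ(γ₀)` (two ordered `ℤ/M`-bases of `A_s̄(Ω)[M] ≅ (ℤ/M)^{2g}` differ by a matrix of `GL`, ★ FILE B1
  `exists_generalLinearGroup_rebase_of_injective` over ★ `exists_mulHom_torsion_fibrePoints`).
These are exactly the inputs of ★ `RelativeSpec/GeometricQuotientOfEtaleCover` (geometric quotient) and of the freeness on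
the affine charts (★ `RelativeSpec/FreeActionOfPoints`, re-proved privately in FILE B3 for a group in any universe), assembled in
FILE B3 into the free-base-quotient carrier of ★ `DualPairBaseQuotientDescent`.

## References
* [MumfordFogartyKirwan1994] D. Mumford, J. Fogarty, F. Kirwan, *Geometric Invariant Theory*, 3rd ed. (1994), Ch. 7 §2 Prop. 7.3,
  proof, step (IV) (pp. 133–134); §3 Lemma 7.11 (p. 140).
* [GortzWedhorn2023] U. Görtz, T. Wedhorn, *Algebraic Geometry II* (2023), Prop. 27.188 (1) (p. 675).
* [SGA1] A. Grothendieck, *SGA 1*, Exp. V, Prop. 2.6, Déf. 2.7.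
-/

noncomputable section

universe u

open CategoryTheory CategoryTheory.Limits AlgebraicGeometry MonoidalCategory CartesianMonoidalCategory Matrix

open scoped MonObj

namespace Literature.AlgebraicGeometry.AbelianSchemes

namespace AbelianSchemeOver

open Literature.AlgebraicGeometry.Morphisms Literature.AlgebraicGeometry.Motives Literature.AlgebraicGeometry.RelativeSpec

variable {S : Scheme.{u}} (A : AbelianSchemeOver S)

/-! ### §1 The basis locus with its `GL`-action, level structure, trivial stabilisers and transitive geometric fibres -/

set_option backward.isDefEq.respectTransparency false in
/-- **THE LEVEL-`M`-BASIS COVER AS A `GL_{2g}(ℤ/M)`-SCHEME** ([MumfordFogartyKirwan1994] Prop. 7.3 step (IV) / Lemma 7.11;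
[GortzWedhorn2023] Prop. 27.188 (1)).  Let `A/S` be an abelian scheme of relative dimension `g` with commutative group law and
`M ≠ 0` invertible in the residue fields of `S`.  There are a FINITE ÉTALE SURJECTIVE `b : B → S` — the clopen basis locus of the
fibre power `T = A[M]^{×_S 2g}` — an ACTION `ρ` of `GL (Fin g ⊕ Fin g) (ℤ/M)` on `B` over `S` (★ `exists_actionOver_rebase`
restricted to the `GL`-stable basis locus) and a LEVEL-`M` STRUCTURE on `A ×_S B` (indeed on `A ×_S W` for every `j : W → B`,
by the same construction — so no transport along `(A_B)_W ≅ A_W` is ever needed), such that (i) STABILISERS ARE TRIVIAL on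
field-valued points (`x ≫ ρ(γ₀) = x ⇒ γ₀ = 1`: `ρ(γ₀)` pulls the combination `Σ aᵢτᵢ` back to `Σ (a ᵥ* γ₀)ⱼ τⱼ`, ★
`comp_prod_pow_val_of_rebase`, and `a ↦ Σ aᵢτᵢ(x)` is injective on the basis locus) and (ii) `GL` is TRANSITIVE ON GEOMETRIC
FIBRES (two `Ω`-points over the same `s̄`, `Ω` algebraically closed, are two ordered bases of `A_s̄(Ω)[M] ≅ (ℤ/M)^{2g}`, ★
`exists_mulHom_torsion_fibrePoints`, which differ by a matrix, ★ `exists_generalLinearGroup_rebase_of_injective`; equality of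
points by the universal properties of `A[M]` and of the fibre power).
[cite: MumfordFogartyKirwan1994, Ch. 7 §2 Proposition 7.3, proof, step (IV) (pp. 133–134)]
[cite: MumfordFogartyKirwan1994, Ch. 7 §3 Lemma 7.11 (p. 140)] [cite: GortzWedhorn2023, Prop. 27.188 (1) (p. 675)] -/
theorem exists_levelBasisCover_rebase [IsCommMonObj A.X] {g M : ℕ} [NeZero M] (hg : A.IsOfRelDim g)
    (hM : ∀ s : S, (M : S.residueField s) ≠ 0) :
    ∃ (B : Scheme.{u}) (b : B ⟶ S) (_ : IsFinite b) (_ : Etale b) (_ : Surjective b)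
      (ρ : ActionOver b (Matrix.GeneralLinearGroup (Fin g ⊕ Fin g) (ZMod M))),
      Nonempty (LevelStructure g M (A.baseChange b)) ∧
      (∀ (W : Scheme.{u}) (j : W ⟶ B), Nonempty (LevelStructure g M (A.baseChange (j ≫ b)))) ∧
      (∀ (Ω : Type u) [Field Ω] (x : Spec (.of Ω) ⟶ B) (γ₀ : Matrix.GeneralLinearGroup (Fin g ⊕ Fin g) (ZMod M)),
        x ≫ (ρ.aut γ₀).hom = x → γ₀ = 1) ∧
      (∀ (Ω : Type u) [Field Ω] [IsAlgClosed Ω] (x₁ x₂ : Spec (.of Ω) ⟶ B), x₁ ≫ b = x₂ ≫ b →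
        ∃ γ₀ : Matrix.GeneralLinearGroup (Fin g ⊕ Fin g) (ZMod M), x₂ = x₁ ≫ (ρ.aut γ₀).hom) := by
  classical
  -- §1a: `A[M]`, the fibre power `T`, the re-basing action on `T`
  obtain ⟨AM, incl, hfin, het, hpow, hlift, hinj⟩ := A.exists_torsion_subscheme hM
  haveI := hfin
  haveI := het
  obtain ⟨T, π, hTfin, hTet, hTex, hTuniq⟩ := exists_power_finite_etale AM (Fin g ⊕ Fin g)
  haveI := hTfin
  haveI := hTet
  obtain ⟨ρT, hρT⟩ := A.exists_actionOver_rebase AM incl hpow hlift hinj T π hTex hTuniq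
  choose u hu huc using hρT
  -- the combinations `P a = Σ aᵢ τᵢ` of the tautological points (product form) and their list form
  obtain ⟨P, hP⟩ : ∃ P : (Fin g ⊕ Fin g → ZMod M) → (T ⟶ A.X), ∀ a, P a = ∏ i, (π i ≫ incl) ^ (a i).val :=
    ⟨_, fun a => rfl⟩
  have hPl : ∀ a, (List.ofFn fun i : Fin g => (π (Sum.inl i) ≫ incl) ^ (a (Sum.inl i)).val).prod *
      (List.ofFn fun i : Fin g => (π (Sum.inr i) ≫ incl) ^ (a (Sum.inr i)).val).prod = P a := fun a => by
    rw [hP]; exact LevelBasis.listProd_pow_mul_listProd_pow_eq_prod (fun i => π i ≫ incl) a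
  have hPpow : ∀ a, P a ^ M = 1 := fun a => by rw [hP]; exact A.prod_pow_val_pow_eq_one AM incl hpow π a
  choose p hp using fun a => hlift T (P a) (hPpow a)
  have hPcomp : ∀ {Y : Over S} (v : Y ⟶ T) (a : Fin g ⊕ Fin g → ZMod M),
      v ≫ P a = ∏ i, (v ≫ π i ≫ incl) ^ (a i).val := fun v a => by rw [hP, A.comp_prod_pow]
  have hPlcomp : ∀ {Y : Over S} (v : Y ⟶ T) (a : Fin g ⊕ Fin g → ZMod M),
      v ≫ P a = (List.ofFn fun i : Fin g => (v ≫ π (Sum.inl i) ≫ incl) ^ (a (Sum.inl i)).val).prod *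
        (List.ofFn fun i : Fin g => (v ≫ π (Sum.inr i) ≫ incl) ^ (a (Sum.inr i)).val).prod := fun v a => by
    rw [hPcomp, LevelBasis.listProd_pow_mul_listProd_pow_eq_prod (fun i => v ≫ π i ≫ incl) a]
  have hPu : ∀ γ₀ a, u γ₀ ≫ P a = P (a ᵥ* (γ₀ : Matrix _ _ (ZMod M))) := fun γ₀ a => by
    rw [hP, hP]; exact A.comp_prod_pow_val_of_rebase AM incl hpow T π (huc γ₀) a
  -- §1b: the equality loci of `P a`, `P b` are open and closed (sections of the finite étale `A[M]_T → T`)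
  obtain ⟨σ, hσ⟩ : ∃ σ : (Fin g ⊕ Fin g → ZMod M) → (T.left ⟶ pullback AM.hom T.hom),
      ∀ a, σ a = pullback.lift (p a).left (𝟙 _) (by rw [Category.id_comp]; exact Over.w (p a)) := ⟨_, fun a => rfl⟩
  have hσq : ∀ a b, σ a ≫ pullback.snd AM.hom T.hom = σ b ≫ pullback.snd AM.hom T.hom := fun a b => by
    rw [hσ, hσ, pullback.lift_snd, pullback.lift_snd]
  have hE : ∀ a b, IsClopen (Set.range (pullback.snd (pullback.diagonal (pullback.snd AM.hom T.hom))
      (pullback.lift (σ a) (σ b) (hσq a b)))) := fun a b => isClopen_range_sectionEqualizer (hσq a b)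
  have hiff : ∀ (a b) {Ω : Type u} [Field Ω] (x : Spec (.of Ω) ⟶ T.left),
      x ≫ (P a).left = x ≫ (P b).left ↔ x (IsLocalRing.closedPoint Ω) ∈
        Set.range (pullback.snd (pullback.diagonal (pullback.snd AM.hom T.hom))
          (pullback.lift (σ a) (σ b) (hσq a b))) := by
    intro a b Ω _ x
    have hrange : Set.range x ⊆ Set.range (pullback.snd (pullback.diagonal (pullback.snd AM.hom T.hom))
        (pullback.lift (σ a) (σ b) (hσq a b))) ↔ x (IsLocalRing.closedPoint Ω) ∈ _ :=
      ⟨fun h => h ⟨_, rfl⟩, fun h => by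
        rintro _ ⟨q, rfl⟩
        rwa [Subsingleton.elim q (IsLocalRing.closedPoint Ω)]⟩
    rw [← hrange, ← comp_eq_comp_iff_range_subset_sectionEqualizer (hσq a b) x]
    have hleft : ∀ c, (p c).left ≫ incl.left = (P c).left := fun c => by rw [← Over.comp_left, hp]
    constructor
    · intro h
      have hx : (x ≫ (p a).left) ≫ AM.hom = x ≫ T.hom := by rw [Category.assoc, Over.w (p a)]
      have hx' : (x ≫ (p b).left) ≫ AM.hom = x ≫ T.hom := by rw [Category.assoc, Over.w (p b)]
      have hw := hinj (Over.mk (x ≫ T.hom)) (Over.homMk (x ≫ (p a).left) hx) (Over.homMk (x ≫ (p b).left) hx')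
        (Over.OverMorphism.ext (by
          change (x ≫ (p a).left) ≫ incl.left = (x ≫ (p b).left) ≫ incl.left
          rw [Category.assoc, Category.assoc, hleft, hleft, h]))
      have hw' : x ≫ (p a).left = x ≫ (p b).left := congrArg Over.Hom.left hw
      apply pullback.hom_ext
      · erw [Category.assoc, Category.assoc, hσ, pullback.lift_fst, hσ, pullback.lift_fst]
        exact hw'
      · erw [Category.assoc, Category.assoc, hσ, pullback.lift_snd, hσ, pullback.lift_snd]
    · intro h
      have h' := congrArg (· ≫ pullback.fst AM.hom T.hom) h
      erw [Category.assoc, Category.assoc, hσ, pullback.lift_fst, hσ, pullback.lift_fst] at h'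
      rw [← hleft, ← hleft, ← Category.assoc, ← Category.assoc, h']
  -- §1c: the basis locus `U` and the injectivity it encodes
  obtain ⟨U, hU⟩ : ∃ U : Set T.left, U = ⋂ q : {q : (Fin g ⊕ Fin g → ZMod M) × (Fin g ⊕ Fin g → ZMod M) // q.1 ≠ q.2},
      (Set.range (pullback.snd (pullback.diagonal (pullback.snd AM.hom T.hom))
        (pullback.lift (σ q.1.1) (σ q.1.2) (hσq q.1.1 q.1.2))))ᶜ := ⟨_, rfl⟩
  have hUclopen : IsClopen U := by
    rw [hU]
    exact isClopen_iInter_of_finite fun q => (hE q.1.1 q.1.2).compl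
  have hUiff : ∀ {Ω : Type u} [Field Ω] (x : Spec (.of Ω) ⟶ T.left),
      x (IsLocalRing.closedPoint Ω) ∈ U ↔ Function.Injective fun a => x ≫ (P a).left := by
    intro Ω _ x
    rw [hU, Set.mem_iInter]
    constructor
    · intro h a b hab
      by_contra hne
      exact h ⟨(a, b), hne⟩ ((hiff a b x).1 hab)
    · rintro h ⟨⟨a, b⟩, hne⟩ hmem
      exact hne (h ((hiff a b x).2 hmem))
  -- on `Over`-points `v : Y → T`: injectivity of `a ↦ v ≫ P a` is injectivity of `a ↦ v.left ≫ (P a).left`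
  have hinjOver : ∀ {Y : Over S} (v : Y ⟶ T),
      (Function.Injective fun a => v.left ≫ (P a).left) ↔ Function.Injective fun a => v ≫ P a := by
    intro Y v
    refine ⟨fun h a b hab => h ?_, fun h a b hab => h (Over.OverMorphism.ext ?_)⟩
    · change v.left ≫ (P a).left = v.left ≫ (P b).left
      rw [← Over.comp_left, ← Over.comp_left]
      exact congrArg Over.Hom.left hab
    · change (v ≫ P a).left = (v ≫ P b).left
      rw [Over.comp_left, Over.comp_left]
      exact hab
  -- §1d: `U` is `GL`-stable
  let U' : T.left.Opens := ⟨U, hUclopen.isOpen⟩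
  have hbij : ∀ γ₀ : Matrix.GeneralLinearGroup (Fin g ⊕ Fin g) (ZMod M),
      Function.Bijective fun a : Fin g ⊕ Fin g → ZMod M => a ᵥ* (γ₀ : Matrix _ _ (ZMod M)) := fun γ₀ =>
    ⟨vecMul_coe_generalLinearGroup_injective γ₀,
      Finite.surjective_of_injective (vecMul_coe_generalLinearGroup_injective γ₀)⟩
  have hUstab : ∀ γ₀ : Matrix.GeneralLinearGroup (Fin g ⊕ Fin g) (ZMod M), (ρT.aut γ₀).hom ⁻¹ᵁ U' = U' := by
    intro γ₀
    ext t
    let x : Spec (.of (T.left.residueField t)) ⟶ T.left := T.left.fromSpecResidueField t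
    have hxt : x (IsLocalRing.closedPoint _) = t := Scheme.fromSpecResidueField_apply t _
    have hγ₀t : (x ≫ (u γ₀).left) (IsLocalRing.closedPoint _) = (ρT.aut γ₀).hom t := by
      rw [Scheme.Hom.comp_apply, hxt, hu]
    change (ρT.aut γ₀).hom t ∈ U ↔ t ∈ U
    have h1 := hUiff x
    rw [hxt] at h1
    have h2 := hUiff (x ≫ (u γ₀).left)
    rw [hγ₀t] at h2
    have hfun : (fun a => (x ≫ (u γ₀).left) ≫ (P a).left) =
        (fun a => x ≫ (P a).left) ∘ fun a => a ᵥ* (γ₀ : Matrix _ _ (ZMod M)) := by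
      funext a
      change (x ≫ (u γ₀).left) ≫ (P a).left = x ≫ (P (a ᵥ* (γ₀ : Matrix _ _ (ZMod M)))).left
      rw [Category.assoc, ← Over.comp_left, hPu]
    rw [h1, h2, hfun]
    exact Function.Injective.of_comp_iff' _ (hbij γ₀)
  -- §1e: the cover `B := U ↪ T → S`, its action and the `U`-points dictionary
  obtain ⟨hfinι, hetι⟩ := isFinite_and_etale_ι_of_isClosed U' hUclopen.isClosed
  haveI := hfinι
  haveI := hetι
  let ρ := ρT.restrict U' hUstab
  have hρι : ∀ γ₀, (ρ.aut γ₀).hom ≫ U'.ι = U'.ι ≫ (u γ₀).left := fun γ₀ => by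
    rw [hu]; exact ρT.restrictHom_ι U' hUstab γ₀
  have hmemU : ∀ {Ω : Type u} [Field Ω] (x : Spec (.of Ω) ⟶ (U' : Scheme.{u})),
      (x ≫ U'.ι) (IsLocalRing.closedPoint Ω) ∈ U := fun x => by
    rw [Scheme.Hom.comp_apply]
    exact (x (IsLocalRing.closedPoint _)).2
  -- §1g THE LEVEL STRUCTURE on `A ×_S W` for every `j : W → B` (in particular on `A ×_S B`): graph sections of the
  -- tautological points, injective on geometric fibres
  have hlev : ∀ (W : Scheme.{u}) (j : W ⟶ (U' : Scheme.{u})),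
      Nonempty (LevelStructure g M (A.baseChange (j ≫ U'.ι ≫ T.hom))) := by
    intro W j
    obtain ⟨ps, hps⟩ := A.exists_pointSectionHom (j ≫ U'.ι ≫ T.hom)
    obtain ⟨w₀, hw₀⟩ : ∃ w₀ : Over.mk (j ≫ U'.ι ≫ T.hom) ⟶ T, w₀.left = j ≫ U'.ι :=
      ⟨Over.homMk (j ≫ U'.ι) (Category.assoc _ _ _), rfl⟩
    have hτM : ∀ i, ps (w₀ ≫ π i ≫ incl) ^ M = 1 := fun i => by
      have h := hpow _ (w₀ ≫ π i)
      rw [Category.assoc] at h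
      rw [← map_pow, h, map_one]
    have hsp : ∀ a, (A.baseChange (j ≫ U'.ι ≫ T.hom)).sectionPow (fun i => ps (w₀ ≫ π i ≫ incl)) a = ps (w₀ ≫ P a) :=
      fun a => by
      rw [hPlcomp]
      exact (map_listProd_pow_mul_listProd_pow ps (fun i => w₀ ≫ π i ≫ incl) a).symm
    obtain ⟨φ, -⟩ := (A.baseChange (j ≫ U'.ι ≫ T.hom)).exists_levelStructure_of_injective (hg.baseChange _)
      (fun t => natCast_residueField_ne_zero_of_hom (j ≫ U'.ι ≫ T.hom) hM t) (fun i => ps (w₀ ≫ π i ≫ incl)) hτM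
      (fun Ω _ _ t => by
        obtain ⟨pt, hpt⟩ : ∃ pt : Over.mk (t ≫ j ≫ U'.ι ≫ T.hom) ⟶ Over.mk (j ≫ U'.ι ≫ T.hom), pt.left = t :=
          ⟨Over.homMk t rfl, rfl⟩
        have hfun : (fun a : Fin g ⊕ Fin g → ZMod M =>
            (A.baseChange (j ≫ U'.ι ≫ T.hom)).restrict t
              ((A.baseChange (j ≫ U'.ι ≫ T.hom)).sectionPow (fun i => ps (w₀ ≫ π i ≫ incl)) a)) =
            fun a => A.fibrePointsBaseChangeEquiv (j ≫ U'.ι ≫ T.hom) t (pt ≫ w₀ ≫ P a) := by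
          funext a
          rw [hsp, hps t pt hpt]
        rw [hfun]
        have hinjx := ((hUiff ((t ≫ j) ≫ U'.ι)).1 (hmemU (t ≫ j)))
        intro a a' h
        apply hinjx
        have h' := congrArg Over.Hom.left ((A.fibrePointsBaseChangeEquiv (j ≫ U'.ι ≫ T.hom) t).injective h)
        rw [Over.comp_left, Over.comp_left, Over.comp_left, Over.comp_left, hpt, hw₀, ← Category.assoc,
          ← Category.assoc, ← Category.assoc] at h'
        exact h')
    exact ⟨φ⟩
  refine ⟨U', U'.ι ≫ T.hom, inferInstance, inferInstance, ⟨fun s₀ => ?_⟩, ρ, ?_, fun W j => ?_, ?_, ?_⟩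
  · -- §1f SURJECTIVITY: the geometric point over `s₀` carries a basis of the `M`-torsion, realised by a point of `U`
    let Ω : Type u := AlgebraicClosure (S.residueField s₀)
    let s : Spec (.of Ω) ⟶ S :=
      Spec.map (CommRingCat.ofHom (algebraMap (S.residueField s₀) Ω)) ≫ S.fromSpecResidueField s₀
    have hs : s (IsLocalRing.closedPoint Ω) = s₀ := by
      change (S.fromSpecResidueField s₀) _ = s₀
      exact Scheme.fromSpecResidueField_apply s₀ _
    have hMΩ : (M : Ω) ≠ 0 := natCast_ne_zero_of_residueField s M hM
    obtain ⟨x, hxM, hxinj⟩ := A.exists_torsionBasis_fibrePoints s hg (NeZero.pos M) hMΩ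
    choose w hw using fun i => hlift (Over.mk s) (x i) (hxM i)
    obtain ⟨v, hv⟩ := hTex (Over.mk s) w
    have hvx : ∀ i, v ≫ π i ≫ incl = x i := fun i => by rw [← Category.assoc, hv, hw]
    obtain ⟨vl, hvl⟩ : ∃ vl : Spec (.of Ω) ⟶ T.left, vl = v.left := ⟨v.left, rfl⟩
    have hmem : vl (IsLocalRing.closedPoint Ω) ∈ U := by
      rw [hUiff vl]
      intro a a' h
      apply hxinj
      have h1 : ∀ c, vl ≫ (P c).left = (v ≫ P c).left := fun c => by rw [hvl, Over.comp_left]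
      dsimp only at h ⊢
      rw [h1, h1] at h
      have h2 := Over.OverMorphism.ext h
      rw [hPcomp, hPcomp] at h2
      simp only [hvx] at h2
      rw [LevelBasis.listProd_pow_mul_listProd_pow_eq_prod, LevelBasis.listProd_pow_mul_listProd_pow_eq_prod]
      exact h2
    have hrange : Set.range vl ⊆ Set.range U'.ι := by
      rintro _ ⟨q, rfl⟩
      rw [Scheme.Opens.range_ι, Subsingleton.elim q (IsLocalRing.closedPoint Ω)]
      exact hmem
    have hvT : vl ≫ T.hom = s := by rw [hvl]; exact Over.w v
    refine ⟨(IsOpenImmersion.lift U'.ι vl hrange) (IsLocalRing.closedPoint Ω), ?_⟩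
    rw [← Scheme.Hom.comp_apply, ← Category.assoc, IsOpenImmersion.lift_fac, hvT]
    exact hs
  · -- the level structure on `A ×_S B` itself: `j := 𝟙`
    have h := hlev _ (𝟙 _)
    rwa [Category.id_comp] at h
  · -- the level structure on `A ×_S W` along `j : W → B`
    exact hlev W j
  · -- §1h TRIVIAL STABILISERS on field-valued points
    intro Ω _ x γ₀ hx
    have hxl : (x ≫ U'.ι) ≫ (u γ₀).left = x ≫ U'.ι := by
      rw [Category.assoc, ← hρι, ← Category.assoc, hx]
    have hinjx := (hUiff (x ≫ U'.ι)).1 (hmemU x)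
    refine generalLinearGroup_eq_one_of_forall_vecMul_eq γ₀ fun a => hinjx ?_
    change (x ≫ U'.ι) ≫ (P (a ᵥ* (γ₀ : Matrix _ _ (ZMod M)))).left = (x ≫ U'.ι) ≫ (P a).left
    rw [← hPu, Over.comp_left, ← Category.assoc, hxl]
  · -- §1i TRANSITIVITY on geometric fibres
    intro Ω _ _ x₁ x₂ h
    -- the two points as `Over`-points of `T` over `s := x₁ ≫ b`, their tuples of `M`-torsion points
    obtain ⟨s, hs₁⟩ : ∃ s : Spec (.of Ω) ⟶ S, (x₁ ≫ U'.ι) ≫ T.hom = s := ⟨_, rfl⟩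
    have hs₂ : (x₂ ≫ U'.ι) ≫ T.hom = s := by rw [← hs₁, Category.assoc, Category.assoc]; exact h.symm
    obtain ⟨v₁, hv₁⟩ : ∃ v₁ : Over.mk s ⟶ T, v₁.left = x₁ ≫ U'.ι := ⟨Over.homMk (x₁ ≫ U'.ι) hs₁, rfl⟩
    obtain ⟨v₂, hv₂⟩ : ∃ v₂ : Over.mk s ⟶ T, v₂.left = x₂ ≫ U'.ι := ⟨Over.homMk (x₂ ≫ U'.ι) hs₂, rfl⟩
    have hinj₁ : Function.Injective fun a : Fin g ⊕ Fin g → ZMod M => ∏ i, (v₁ ≫ π i ≫ incl) ^ (a i).val := by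
      have h1 := (hinjOver v₁).1 (by rw [hv₁]; exact (hUiff (x₁ ≫ U'.ι)).1 (hmemU x₁))
      simpa only [hPcomp] using h1
    have hinj₂ : Function.Injective fun a : Fin g ⊕ Fin g → ZMod M => ∏ i, (v₂ ≫ π i ≫ incl) ^ (a i).val := by
      have h2 := (hinjOver v₂).1 (by rw [hv₂]; exact (hUiff (x₂ ≫ U'.ι)).1 (hmemU x₂))
      simpa only [hPcomp] using h2
    -- `A_s̄(Ω)[M] ≅ (ℤ/M)^{2g}`, so the two ordered bases differ by `γ₀ ∈ GL`
    have hMΩ : (M : Ω) ≠ 0 := natCast_ne_zero_of_residueField s M hM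
    obtain ⟨φ, -, hφrange⟩ := A.exists_mulHom_torsion_fibrePoints s hg (NeZero.pos M) hMΩ
    obtain ⟨γ₀, hγ₀⟩ := exists_generalLinearGroup_rebase_of_injective φ hφrange (fun i => v₁ ≫ π i ≫ incl)
      (fun i => v₂ ≫ π i ≫ incl) (fun i => by rw [← Category.assoc]; exact hpow _ _)
      (fun i => by rw [← Category.assoc]; exact hpow _ _) hinj₁ hinj₂
    refine ⟨γ₀, ?_⟩
    -- `v₂ = v₁ ≫ u γ₀` by the universal properties, then descend to `U`-points
    have hv : v₂ = v₁ ≫ u γ₀ := by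
      refine hTuniq _ _ _ fun i => hinj _ _ _ ?_
      rw [Category.assoc, Category.assoc, Category.assoc, huc, A.comp_prod_pow]
      exact hγ₀ i
    have hl : x₂ ≫ U'.ι = (x₁ ≫ (ρ.aut γ₀).hom) ≫ U'.ι := by
      rw [← hv₂, hv, Over.comp_left, hv₁, Category.assoc, Category.assoc, hρι]
    exact (cancel_mono U'.ι).1 hl

end AbelianSchemeOver

end Literature.AlgebraicGeometry.AbelianSchemes

end
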